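import Summits.SmoothPoincare4.SmoothPoincare4.Theorems.CylinderEntropyCylinderRungTwoHamiltonMonotonicityDivergence
import Mathlib.Analysis.SpecialFunctions.ExpDeriv
import Mathlib.Analysis.InnerProductSpace.Calculus
import HarnessLib

/-!
# Route `CylinderEntropy`, crux `CylinderRungTwo` (stmt-SmoothPoincare4-7631), line `killing-flux`:
# calculus of the Gaussian weight `G(z) = (4πτ)⁻² exp(-|z - x₀|² / 4τ)` on `ℝ⁶`
# (registered helpers `helper_gaussianWeight_contDiff`, `helper_gaussianWeight_fderiv`,
# `helper_gaussianWeight_iteratedFDeriv_two`, `helper_gaussianWeight_laplacian`)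

The static Gaussian (Colding–Minicozzi / Ecker) monotonicity for closed cross-sections
`f : M⁴ → N = S⁴ × ℝ ⊂ ℝ⁶` is Green's identity `∫_M Δ_g(φ ∘ f) dμ_g = 0`
(`integral_sliceLaplacian_eq_zero`, `…HamiltonMonotonicityDivergence.lean`) for the backward heat
kernel weight of `ℝ⁴ ⊂ ℝ⁶` centred at `x₀` at scale `τ > 0`,

  `G(z) = exp(-|z - x₀|² / (4τ)) / (4πτ)²`.

This file is the calculus of `G` consumed by that identity: with `r = z - x₀`,

* `helper_gaussianWeight_contDiff` — `G ∈ C²(ℝ⁶)`;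
* `hasFDerivAt_gaussianWeight`, `helper_gaussianWeight_fderiv` — `DG_z(v) = -G(z) ⟨r, v⟩ / (2τ)`;
* `helper_gaussianWeight_iteratedFDeriv_two` — `D²G_z(v, v) = G(z) (⟨r, v⟩² / (4τ²) - |v|² / (2τ))`;
* `helper_gaussianWeight_laplacian` — `Δ_{ℝ⁶} G = ∑ⱼ D²G(eⱼ, eⱼ) = G (|r|² / (4τ²) - 3 / τ)`.

The proofs are the chain rule through the profile `s ↦ exp(-s / 4τ) / (4πτ)²` and `z ↦ |z - x₀|²`
(`HasFDerivAt.norm_sq`), and one more product rule for the second derivative, evaluated through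
`D²G_z(v, v) = D(p ↦ DG_p(v))_z(v)` (`HasFDerivAt.clm_apply`).

Everything here is PROVED (no `sorry`, no new definitions, no named facts).

References: T. H. Colding, W. P. Minicozzi II, Generic mean curvature flow I; generic
singularities, Ann. of Math. 175 (2012), §3 (the Gaussian weight of the `F`-functional);
K. Ecker, *Regularity Theory for Mean Curvature Flow* (2004), Prop. 3.16.
-/

-- the prescribed namespace `Summit.SmoothPoincare4.SmoothPoincare4.…` repeats `SmoothPoincare4`
set_option linter.dupNamespace false

noncomputable section

open Bundle Set Function Filter MeasureTheory Module
open scoped Manifold ContDiff Topology RealInnerProductSpace BigOperators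

namespace Summit.SmoothPoincare4.SmoothPoincare4.Cruxes.CylinderRungTwo.KillingFlux

/-! ## First derivatives of the Gaussian weight -/

section GaussianWeight

variable (x₀ : EuclideanSpace ℝ (Fin 6)) (τ : ℝ)

/-- The radial profile `s ↦ exp(-s / (4τ)) / (4πτ)²` of the Gaussian weight has derivative
`-(4τ)⁻¹` times itself. [folklore] -/
theorem hasDerivAt_gaussianProfile (s : ℝ) :
    HasDerivAt (fun s : ℝ => Real.exp (-s / (4 * τ)) / (4 * Real.pi * τ) ^ 2)
      (Real.exp (-s / (4 * τ)) / (4 * Real.pi * τ) ^ 2 * (-1 / (4 * τ))) s := by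
  have h1 : HasDerivAt (fun s : ℝ => -s / (4 * τ)) (-1 / (4 * τ)) s :=
    ((hasDerivAt_id' s).fun_neg).div_const (4 * τ)
  have h2 := (h1.exp).div_const ((4 * Real.pi * τ) ^ 2)
  exact h2.congr_deriv (by ring)

/-- `z ↦ |z - x₀|²` has derivative `2 ⟨z - x₀, ·⟩` (`HasFDerivAt.norm_sq`). [folklore] -/
theorem hasFDerivAt_normSq_sub (z : EuclideanSpace ℝ (Fin 6)) :
    HasFDerivAt (fun z : EuclideanSpace ℝ (Fin 6) => ‖z - x₀‖ ^ 2)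
      (2 • (innerSL ℝ (z - x₀) : EuclideanSpace ℝ (Fin 6) →L[ℝ] ℝ)) z := by
  have h := (hasFDerivAt_sub_const (𝕜 := ℝ) (x := z) x₀).norm_sq
  rwa [ContinuousLinearMap.comp_id] at h

/-- **The derivative of the Gaussian weight**: `DG_z = (-G(z) / (2τ)) ⟨z - x₀, ·⟩` (chain rule
through the profile `hasDerivAt_gaussianProfile` and `hasFDerivAt_normSq_sub`).
[cite: ColdingMinicozzi2012, §3] -/
theorem hasFDerivAt_gaussianWeight (z : EuclideanSpace ℝ (Fin 6)) :
    HasFDerivAt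
      (fun z : EuclideanSpace ℝ (Fin 6) => Real.exp (-‖z - x₀‖ ^ 2 / (4 * τ)) / (4 * Real.pi * τ) ^ 2)
      ((-(Real.exp (-‖z - x₀‖ ^ 2 / (4 * τ)) / (4 * Real.pi * τ) ^ 2) / (2 * τ)) •
        (innerSL ℝ (z - x₀) : EuclideanSpace ℝ (Fin 6) →L[ℝ] ℝ)) z := by
  have h := (hasDerivAt_gaussianProfile τ (‖z - x₀‖ ^ 2)).comp_hasFDerivAt z
    (hasFDerivAt_normSq_sub x₀ z)
  -- unfold the composition (definitionally) and tidy the derivative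
  have h' : HasFDerivAt
      (fun z : EuclideanSpace ℝ (Fin 6) => Real.exp (-‖z - x₀‖ ^ 2 / (4 * τ)) / (4 * Real.pi * τ) ^ 2)
      _ z := h
  refine h'.congr_fderiv ?_
  ext v
  simp only [smul_apply, innerSL_apply_apply, smul_eq_mul, nsmul_eq_mul, Nat.cast_ofNat]
  ring

end GaussianWeight

/-! ## The registered helpers -/

/-- **Registered helper `helper_gaussianWeight_contDiff`**: the Gaussian weight
`G(z) = exp(-|z - x₀|² / (4τ)) / (4πτ)²` is of class `C²` on `ℝ⁶` (a constant multiple of the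
exponential of a quadratic polynomial). [cite: ColdingMinicozzi2012, §3] -/
theorem helper_gaussianWeight_contDiff : ∀ (x₀ : EuclideanSpace ℝ (Fin 6)) (τ : ℝ), 0 < τ → ContDiff ℝ 2 (fun z : EuclideanSpace ℝ (Fin 6) => Real.exp (-‖z - x₀‖ ^ 2 / (4 * τ)) / (4 * Real.pi * τ) ^ 2) := by
  intro x₀ τ _
  exact ((((contDiff_id.sub contDiff_const).norm_sq ℝ).neg.div_const (4 * τ)).exp).div_const _

/-- **Registered helper `helper_gaussianWeight_fderiv`**: `DG_z(v) = -G(z) ⟨z - x₀, v⟩ / (2τ)` for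
the Gaussian weight `G(z) = exp(-|z - x₀|² / (4τ)) / (4πτ)²` (`hasFDerivAt_gaussianWeight`).
[cite: ColdingMinicozzi2012, §3] -/
theorem helper_gaussianWeight_fderiv : ∀ (x₀ : EuclideanSpace ℝ (Fin 6)) (τ : ℝ), 0 < τ → ∀ z v : EuclideanSpace ℝ (Fin 6), fderiv ℝ (fun z : EuclideanSpace ℝ (Fin 6) => Real.exp (-‖z - x₀‖ ^ 2 / (4 * τ)) / (4 * Real.pi * τ) ^ 2) z v = -(Real.exp (-‖z - x₀‖ ^ 2 / (4 * τ)) / (4 * Real.pi * τ) ^ 2) * (inner ℝ (z - x₀) v / (2 * τ)) := by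
  intro x₀ τ _ z v
  rw [(hasFDerivAt_gaussianWeight x₀ τ z).fderiv, smul_apply, innerSL_apply_apply, smul_eq_mul]
  ring

/-- **Registered helper `helper_gaussianWeight_iteratedFDeriv_two`**:
`D²G_z(v, v) = G(z) (⟨z - x₀, v⟩² / (4τ²) - |v|² / (2τ))` for the Gaussian weight
`G(z) = exp(-|z - x₀|² / (4τ)) / (4πτ)²`: `D²G_z(v, v) = D(p ↦ DG_p(v))_z(v)`
(`HasFDerivAt.clm_apply`, `G ∈ C²`), and `p ↦ DG_p(v) = -G(p) ⟨p - x₀, v⟩ / (2τ)` is differentiated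
by the product rule. [cite: ColdingMinicozzi2012, §3] -/
theorem helper_gaussianWeight_iteratedFDeriv_two : ∀ (x₀ : EuclideanSpace ℝ (Fin 6)) (τ : ℝ), 0 < τ → ∀ z v : EuclideanSpace ℝ (Fin 6), iteratedFDeriv ℝ 2 (fun z : EuclideanSpace ℝ (Fin 6) => Real.exp (-‖z - x₀‖ ^ 2 / (4 * τ)) / (4 * Real.pi * τ) ^ 2) z ![v, v] = (Real.exp (-‖z - x₀‖ ^ 2 / (4 * τ)) / (4 * Real.pi * τ) ^ 2) * (inner ℝ (z - x₀) v ^ 2 / (4 * τ ^ 2) - ‖v‖ ^ 2 / (2 * τ)) := by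
  intro x₀ τ hτ z v
  set G : EuclideanSpace ℝ (Fin 6) → ℝ := fun z =>
    Real.exp (-‖z - x₀‖ ^ 2 / (4 * τ)) / (4 * Real.pi * τ) ^ 2 with hG
  have hG2 : ContDiff ℝ 2 G := helper_gaussianWeight_contDiff x₀ τ hτ
  have hd : Differentiable ℝ (fderiv ℝ G) :=
    (hG2.fderiv_right (m := 1) (by norm_num)).differentiable one_ne_zero
  -- `D²G_z(v, v) = D(p ↦ DG_p(v))_z(v)`
  have h1 : iteratedFDeriv ℝ 2 G z ![v, v] = fderiv ℝ (fun p => fderiv ℝ G p v) z v := by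
    rw [iteratedFDeriv_two_apply, ((hd z).hasFDerivAt.clm_apply (hasFDerivAt_const v z)).fderiv]
    simp
  -- `p ↦ DG_p(v)` explicitly
  have h2 : (fun p => fderiv ℝ G p v) = fun p => -G p * (⟪p - x₀, v⟫ / (2 * τ)) :=
    funext fun p => helper_gaussianWeight_fderiv x₀ τ hτ p v
  -- the product rule
  have hGd : HasFDerivAt G ((-G z / (2 * τ)) •
      (innerSL ℝ (z - x₀) : EuclideanSpace ℝ (Fin 6) →L[ℝ] ℝ)) z :=
    hasFDerivAt_gaussianWeight x₀ τ z
  have hI₀ := ((hasDerivAt_id' (⟪z - x₀, v⟫)).div_const (2 * τ)).comp_hasFDerivAt z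
    ((hasFDerivAt_sub_const x₀).inner ℝ (hasFDerivAt_const v z))
  have hI : HasFDerivAt (fun p : EuclideanSpace ℝ (Fin 6) => ⟪p - x₀, v⟫ / (2 * τ)) _ z := hI₀
  have h3 : HasFDerivAt (fun p => -G p * (⟪p - x₀, v⟫ / (2 * τ))) _ z := hGd.fun_neg.fun_mul hI
  rw [h1, h2, h3.fderiv]
  simp only [add_apply, smul_apply, neg_apply, ContinuousLinearMap.coe_comp, Function.comp_apply,
    ContinuousLinearMap.prod_apply, ContinuousLinearMap.coe_id', id, zero_apply,
    fderivInnerCLM_apply, innerSL_apply_apply, inner_zero_right, real_inner_self_eq_norm_sq,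
    smul_eq_mul]
  ring

/-- **Registered helper `helper_gaussianWeight_laplacian`**: the Euclidean Laplacian of the
Gaussian weight `G(z) = exp(-|z - x₀|² / (4τ)) / (4πτ)²` on `ℝ⁶` is
`∑ⱼ D²G_z(eⱼ, eⱼ) = G(z) (|z - x₀|² / (4τ²) - 3 / τ)` (sum `helper_gaussianWeight_iteratedFDeriv_two`
over the standard basis: `∑ⱼ ⟨z - x₀, eⱼ⟩² = |z - x₀|²`, `∑ⱼ |eⱼ|² = 6`).
[cite: ColdingMinicozzi2012, §3] -/
theorem helper_gaussianWeight_laplacian : ∀ (x₀ : EuclideanSpace ℝ (Fin 6)) (τ : ℝ), 0 < τ → ∀ z : EuclideanSpace ℝ (Fin 6), ∑ j : Fin 6, iteratedFDeriv ℝ 2 (fun z : EuclideanSpace ℝ (Fin 6) => Real.exp (-‖z - x₀‖ ^ 2 / (4 * τ)) / (4 * Real.pi * τ) ^ 2) z ![EuclideanSpace.single j (1 : ℝ), EuclideanSpace.single j (1 : ℝ)] = (Real.exp (-‖z - x₀‖ ^ 2 / (4 * τ)) / (4 * Real.pi * τ) ^ 2) * (‖z - x₀‖ ^ 2 / (4 *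 τ ^ 2) - 3 / τ) := by
  intro x₀ τ hτ z
  have hn : ‖z - x₀‖ ^ 2 = ∑ i, (z - x₀) i ^ 2 := EuclideanSpace.real_norm_sq_eq _
  simp only [helper_gaussianWeight_iteratedFDeriv_two x₀ τ hτ, EuclideanSpace.inner_single_right,
    one_mul, conj_trivial, PiLp.norm_single, norm_one, one_pow]
  rw [hn, Fin.sum_univ_six, Fin.sum_univ_six]
  ring

end Summit.SmoothPoincare4.SmoothPoincare4.Cruxes.CylinderRungTwo.KillingFlux

end
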